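import Summits.HodgeConjecture.HodgeConjecture.Theorems.Ring2WeilCoverageTypeNormSignPrincipal
import Summits.HodgeConjecture.HodgeConjecture.Theorems.Ring2WeilCoverageCyclotomicSignaturesG12
import Summits.HodgeConjecture.HodgeConjecture.Theorems.Ring2WeilCoverageCyclotomicSignaturesG12C
import Summits.HodgeConjecture.HodgeConjecture.Theorems.Ring2WeilCoverageRealUnitNormTwelve
import Summits.HodgeConjecture.HodgeConjecture.Theorems.Ring2WeilCoverageCMTypeSetOddPositions
import HarnessLib

/-!
# Weil-type family coverage — THE NORM-SIGN LAW AT THE LEVELS 84, 72: on every census row `(ℚ(ζ_M), K)` the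
# `ι`-compatible polarisation types `(ϖ₀)` carried by the `K`-balanced points `ℂ^Φ/Φ(ℤ[ζ_M])` are EXACTLY the real
# generators `ϖ₀ ∈ 𝓞 ℚ(ζ_M)⁺` with `N(ϖ₀) < 0` (NO rows) resp. `N(ϖ₀) > 0` (YES rows)

research route conditional on HC_CM; not a corollary; Q11.4-sentence-2 already refuted in dim ≥ 3.

Ring 2, WEIL-TYPE FAMILY-COVERAGE CENSUS (`HOME/WEIL-FAMILY-COVERAGE.md` `## b01`, blocks b01.34–b01.41; owner ring2-b01),
part 56f of the `Ring2WeilCoverage*` series: the level files of part 55/55b (`…TypeNormSign`, `…TypeNormSignPrincipal`: for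
any CM field, under THEOREM L (i)/(ii), «type `(ϖ₀)` occurs on `ℂ^Φ/D(𝔪)`» ⟺ («principal» ⟺ `N_{K⁺/ℚ}(ϖ₀) > 0`)).  At the
levels `M ∈ {84, 72}` (`g = 12`; YES rows only (`h = 1` at `84`, `h = 3` at `72`), THEOREM L (i) by part 57) THEOREM L (i) (`norm_realUnits_pos_M`: every unit of `ℤ[ζ_M]⁺` has norm `+1`)
and THEOREM L (ii) (`exists_units_sign_eq_M`: every even sign pattern is a unit pattern) are hypothesis-free tree theorems
(parts 8/9/15/18/30/30′/31/48b/57), and the principal verdict of a `K`-balanced `Φ` is the residue bit `n₋(M, K) =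
#{t ∈ N_K : 2t < M} (mod 2)` (part 5′ `card_inter_nodd_mod_two_eq`, THEOREM F).  Hence, for EVERY real `ϖ₀ ∈ 𝓞 K⁺ ∖ 0`
at once (no residue sign dictionary, unlike parts 48–54 which treated one generator per file):

* NO rows (): **type `(ϖ₀)` occurs ⟺ `N_{K⁺/ℚ}(ϖ₀) < 0`**;
* YES rows (`(84, ℚ(i))`, `(84, ℚ(√−3))`, `(84, ℚ(√−7))`, `(84, ℚ(√−21))`, `(72, ℚ(i))`, `(72, ℚ(√−2))`, `(72, ℚ(√−3))`, `(72, ℚ(√−6))`): **type `(ϖ₀)` occurs ⟺ `N_{K⁺/ℚ}(ϖ₀) > 0`**;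
* every level, EVERY CM type `Φ`: `N(ϖ₀) < 0` ⇒ exactly one of «principal», «type `(ϖ₀)`»; `N(ϖ₀) > 0` ⇒ both or neither.

At `84` (`h(ℚ(ζ₈₄)) = 1` [Was97 Thm. 11.1]) and at `72` (`h(ℚ(ζ₇₂)) = 3`, `h(ℚ(ζ₇₂)⁺) = 1` [Was97 §8.3, tables]) every type `𝔣₀ ⊆ 𝓞 K⁺` is
principal, so these rows list ALL `ι`-compatible polarisation types of the `K`-balanced `ℤ[ζ_M]`-points (at `72` on the
principal lattice; the two non-principal lattice classes carry the same verdicts by part 46/47 `principal_iff_of_mul_conjIdeal_eq`) (S-pencil remark; the kernel statements quantify over principal types `(ϖ₀)`).  The polarisation of type `(ϖ₀)` has degree `|N_{K⁺/ℚ}(ϖ₀)|`; by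
b01.41 (C) (S-pencil) its hermitian discriminant class is `[−N_{K⁺/ℚ}(ϖ₀)]·[−1]^n…` — i.e. the component `(n, K, a)` with
`a ≡ |N(ϖ₀)|` on the NO rows.

Theorems:
* `exists_type_iff_norm_pos_eightyFour_sqrt_neg_one`
* `exists_type_iff_norm_pos_eightyFour_sqrt_neg_three`
* `exists_type_iff_norm_pos_eightyFour_sqrt_neg_seven`
* `exists_type_iff_norm_pos_eightyFour_sqrt_neg_twentyOne`
* `xor_principal_type_eightyFour_of_norm_neg`
* `exists_type_iff_principal_eightyFour_of_norm_pos`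
* `exists_type_iff_norm_pos_seventyTwo_sqrt_neg_one`
* `exists_type_iff_norm_pos_seventyTwo_sqrt_neg_two`
* `exists_type_iff_norm_pos_seventyTwo_sqrt_neg_three`
* `exists_type_iff_norm_pos_seventyTwo_sqrt_neg_six`
* `xor_principal_type_seventyTwo_of_norm_neg`
* `exists_type_iff_principal_seventyTwo_of_norm_pos`

HONEST FRAMING: torus-level statements about Shimura's divisors of type `(K; Φ; 𝔣₀)` [Sh98 §14.3 Prop. 4–5] on
`ℂ^Φ/Φ(ℤ[ζ_M])` and norms of elements of `ℚ(ζ_M)⁺`; nothing here is a statement about Hodge classes, `W_K`, general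
members or HC; `HC_CM` is used nowhere.  No `def`, no named fact, no `sorry`.

References: [cite: Shimura1998, §14.3 Prop. 4–5, pp. 103–104]; [cite: Washington1997, Thm. 11.1]; census b01.41 (seat-derived).
-/

noncomputable section

open Polynomial NumberField Complex Finset
open scoped Real nonZeroDivisors

namespace Summit.HodgeConjecture.Ring2WeilCoverage.TypeNormSignLevelsG12B

open Literature.AlgebraicGeometry.Motives (CMType)
open Literature.AlgebraicGeometry.HodgeTheory (IsCMTypeSet)
open Literature.AlgebraicGeometry.ComplexMultiplication.CyclotomicCMType (isCMTypeSet_residueFilter)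
open Literature.NumberTheory.ComplexMultiplication
open Summit.HodgeConjecture.Ring2WeilCoverage.TypeNormSign
open Summit.HodgeConjecture.Ring2WeilCoverage.CyclotomicDifferent (xi_ne_zero isOfType_one_xi_top)
open Summit.HodgeConjecture.Ring2WeilCoverage.CyclotomicPrincipalObstruction (complexConj_xi)
open Summit.HodgeConjecture.Ring2WeilCoverage.CMTypeSetOddPositions (card_inter_nodd_mod_two_eq)
open Summit.HodgeConjecture.Ring2WeilCoverage.RealUnitNormTwelve (norm_realUnits_pos_eightyFour)
open Summit.HodgeConjecture.Ring2WeilCoverage.CyclotomicSignaturesG12 (exists_units_sign_eq_eightyFour)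
open Summit.HodgeConjecture.Ring2WeilCoverage.RealUnitNormTwelve (norm_realUnits_pos_seventyTwo)
open Summit.HodgeConjecture.Ring2WeilCoverage.CyclotomicSignaturesG12C (exists_units_sign_eq_seventyTwo)

variable {K : Type} [Field K] [NumberField K] {ζ : K}

/-- `𝐞(t) = exp(2πi t/n) ∈ ℂ` (`ZMod.toCircle`). -/
local notation3 (prettyPrint := false) "𝐞 " t:max => ((ZMod.toCircle t : Circle) : ℂ)

/-! ### Level `84` (`g = 24`) -/

section Level84

/-- the residue set `S_Φ` read at level `84`. -/
local notation3 (prettyPrint := false) "SΦ84[" Φ "," z "]" =>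
  (Finset.univ.filter fun t : ZMod 84 => ∃ σ ∈ (Φ : CMType K).1, σ (z : K) = 𝐞 t)

open scoped Classical in
/-- **CENSUS ROW `(ℚ(ζ_84), ℚ(i))` — THE TYPE SPECTRUM (a YES row: an `ι`-compatible principal polarisation exists).**
For every CM type `Φ` of `ℚ(ζ_84)` balanced for `N_K = [11, 19, 23, 31, 43, 47, 55, 59, 67, 71, 79, 83]` (`K = ℚ(i)`) and EVERY real integer `ϖ₀ ∈ 𝓞 K⁺ ∖ 0`:
`ℂ^Φ/Φ(ℤ[ζ_84])` carries a `Φ`-positive divisor of type `(K; Φ; (ϖ₀))` **iff `N_{K⁺/ℚ}(ϖ₀) > 0`** (part 55b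
`exists_type_span_iff_norm_pos_of_even` + THEOREM L (i)/(ii) at `84` + `|S_Φ ∩ N_odd| ≡ n₋ = 4`); in particular NONE
of the generators of negative norm (the ramified `𝔮_p` and the surd types of parts 49–54) gives a type on this row.
research route conditional on HC_CM; not a corollary; Q11.4-sentence-2 already refuted in dim ≥ 3. [cite: Shimura1998, §14.3 Prop. 4–5, pp. 103–104] -/
theorem exists_type_iff_norm_pos_eightyFour_sqrt_neg_one [IsCMField K] [IsCyclotomicExtension {84} ℚ K] (hζ : IsPrimitiveRoot ζ 84)
    (Φ : CMType K) (hbal : 2 * (SΦ84[Φ, ζ] ∩ ({11, 19, 23, 31, 43, 47, 55, 59, 67, 71, 79, 83} : Finset (ZMod 84))).card = (SΦ84[Φ, ζ]).card)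
    {ϖ₀ : 𝓞 (maximalRealSubfield K)} (hϖ0 : ϖ₀ ≠ 0) :
    (∃ ζ' : K, IsCMField.complexConj K ζ' = -ζ' ∧ (∀ φ : Φ.1, 0 < (φ.1 ζ').im) ∧
        CMTypeLattice.IsOfType (1 : (FractionalIdeal (𝓞 K)⁰ K)ˣ) ζ' (Ideal.span {ϖ₀})) ↔
      0 < Algebra.norm ℚ ((ϖ₀ : maximalRealSubfield K)) := by
  have hg : Nat.totient 84 = 2 * (11 + 1) := by decide
  refine exists_type_span_iff_norm_pos_of_even hζ hg Φ hϖ0 (norm_realUnits_pos_eightyFour hζ) (exists_units_sign_eq_eightyFour hζ Φ) ?_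
  have hS := isCMTypeSet_residueFilter hζ Φ
  have hNK : IsCMTypeSet 84 ({11, 19, 23, 31, 43, 47, 55, 59, 67, 71, 79, 83} : Finset (ZMod 84)) := by decide
  have h := card_inter_nodd_mod_two_eq (m := 84) (by norm_num) hS hNK hbal
  have hn : ((({11, 19, 23, 31, 43, 47, 55, 59, 67, 71, 79, 83} : Finset (ZMod 84))).filter fun t : ZMod 84 => 2 * t.val < 84).card % 2 = 0 := by
    decide
  rw [hn] at h
  exact Nat.even_iff.mpr h

open scoped Classical in
/-- **CENSUS ROW `(ℚ(ζ_84), ℚ(√−3))` — THE TYPE SPECTRUM (a YES row: an `ι`-compatible principal polarisation exists).**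
For every CM type `Φ` of `ℚ(ζ_84)` balanced for `N_K = [5, 11, 17, 23, 29, 41, 47, 53, 59, 65, 71, 83]` (`K = ℚ(√−3)`) and EVERY real integer `ϖ₀ ∈ 𝓞 K⁺ ∖ 0`:
`ℂ^Φ/Φ(ℤ[ζ_84])` carries a `Φ`-positive divisor of type `(K; Φ; (ϖ₀))` **iff `N_{K⁺/ℚ}(ϖ₀) > 0`** (part 55b
`exists_type_span_iff_norm_pos_of_even` + THEOREM L (i)/(ii) at `84` + `|S_Φ ∩ N_odd| ≡ n₋ = 6`); in particular NONE
of the generators of negative norm (the ramified `𝔮_p` and the surd types of parts 49–54) gives a type on this row.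
research route conditional on HC_CM; not a corollary; Q11.4-sentence-2 already refuted in dim ≥ 3. [cite: Shimura1998, §14.3 Prop. 4–5, pp. 103–104] -/
theorem exists_type_iff_norm_pos_eightyFour_sqrt_neg_three [IsCMField K] [IsCyclotomicExtension {84} ℚ K] (hζ : IsPrimitiveRoot ζ 84)
    (Φ : CMType K) (hbal : 2 * (SΦ84[Φ, ζ] ∩ ({5, 11, 17, 23, 29, 41, 47, 53, 59, 65, 71, 83} : Finset (ZMod 84))).card = (SΦ84[Φ, ζ]).card)
    {ϖ₀ : 𝓞 (maximalRealSubfield K)} (hϖ0 : ϖ₀ ≠ 0) :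
    (∃ ζ' : K, IsCMField.complexConj K ζ' = -ζ' ∧ (∀ φ : Φ.1, 0 < (φ.1 ζ').im) ∧
        CMTypeLattice.IsOfType (1 : (FractionalIdeal (𝓞 K)⁰ K)ˣ) ζ' (Ideal.span {ϖ₀})) ↔
      0 < Algebra.norm ℚ ((ϖ₀ : maximalRealSubfield K)) := by
  have hg : Nat.totient 84 = 2 * (11 + 1) := by decide
  refine exists_type_span_iff_norm_pos_of_even hζ hg Φ hϖ0 (norm_realUnits_pos_eightyFour hζ) (exists_units_sign_eq_eightyFour hζ Φ) ?_
  have hS := isCMTypeSet_residueFilter hζ Φ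
  have hNK : IsCMTypeSet 84 ({5, 11, 17, 23, 29, 41, 47, 53, 59, 65, 71, 83} : Finset (ZMod 84)) := by decide
  have h := card_inter_nodd_mod_two_eq (m := 84) (by norm_num) hS hNK hbal
  have hn : ((({5, 11, 17, 23, 29, 41, 47, 53, 59, 65, 71, 83} : Finset (ZMod 84))).filter fun t : ZMod 84 => 2 * t.val < 84).card % 2 = 0 := by
    decide
  rw [hn] at h
  exact Nat.even_iff.mpr h

open scoped Classical in
/-- **CENSUS ROW `(ℚ(ζ_84), ℚ(√−7))` — THE TYPE SPECTRUM (a YES row: an `ι`-compatible principal polarisation exists).**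
For every CM type `Φ` of `ℚ(ζ_84)` balanced for `N_K = [5, 13, 17, 19, 31, 41, 47, 55, 59, 61, 73, 83]` (`K = ℚ(√−7)`) and EVERY real integer `ϖ₀ ∈ 𝓞 K⁺ ∖ 0`:
`ℂ^Φ/Φ(ℤ[ζ_84])` carries a `Φ`-positive divisor of type `(K; Φ; (ϖ₀))` **iff `N_{K⁺/ℚ}(ϖ₀) > 0`** (part 55b
`exists_type_span_iff_norm_pos_of_even` + THEOREM L (i)/(ii) at `84` + `|S_Φ ∩ N_odd| ≡ n₋ = 6`); in particular NONE
of the generators of negative norm (the ramified `𝔮_p` and the surd types of parts 49–54) gives a type on this row.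
research route conditional on HC_CM; not a corollary; Q11.4-sentence-2 already refuted in dim ≥ 3. [cite: Shimura1998, §14.3 Prop. 4–5, pp. 103–104] -/
theorem exists_type_iff_norm_pos_eightyFour_sqrt_neg_seven [IsCMField K] [IsCyclotomicExtension {84} ℚ K] (hζ : IsPrimitiveRoot ζ 84)
    (Φ : CMType K) (hbal : 2 * (SΦ84[Φ, ζ] ∩ ({5, 13, 17, 19, 31, 41, 47, 55, 59, 61, 73, 83} : Finset (ZMod 84))).card = (SΦ84[Φ, ζ]).card)
    {ϖ₀ : 𝓞 (maximalRealSubfield K)} (hϖ0 : ϖ₀ ≠ 0) :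
    (∃ ζ' : K, IsCMField.complexConj K ζ' = -ζ' ∧ (∀ φ : Φ.1, 0 < (φ.1 ζ').im) ∧
        CMTypeLattice.IsOfType (1 : (FractionalIdeal (𝓞 K)⁰ K)ˣ) ζ' (Ideal.span {ϖ₀})) ↔
      0 < Algebra.norm ℚ ((ϖ₀ : maximalRealSubfield K)) := by
  have hg : Nat.totient 84 = 2 * (11 + 1) := by decide
  refine exists_type_span_iff_norm_pos_of_even hζ hg Φ hϖ0 (norm_realUnits_pos_eightyFour hζ) (exists_units_sign_eq_eightyFour hζ Φ) ?_
  have hS := isCMTypeSet_residueFilter hζ Φ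
  have hNK : IsCMTypeSet 84 ({5, 13, 17, 19, 31, 41, 47, 55, 59, 61, 73, 83} : Finset (ZMod 84)) := by decide
  have h := card_inter_nodd_mod_two_eq (m := 84) (by norm_num) hS hNK hbal
  have hn : ((({5, 13, 17, 19, 31, 41, 47, 55, 59, 61, 73, 83} : Finset (ZMod 84))).filter fun t : ZMod 84 => 2 * t.val < 84).card % 2 = 0 := by
    decide
  rw [hn] at h
  exact Nat.even_iff.mpr h

open scoped Classical in
/-- **CENSUS ROW `(ℚ(ζ_84), ℚ(√−21))` — THE TYPE SPECTRUM (a YES row: an `ι`-compatible principal polarisation exists).**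
For every CM type `Φ` of `ℚ(ζ_84)` balanced for `N_K = [13, 29, 43, 47, 53, 59, 61, 65, 67, 73, 79, 83]` (`K = ℚ(√−21)`) and EVERY real integer `ϖ₀ ∈ 𝓞 K⁺ ∖ 0`:
`ℂ^Φ/Φ(ℤ[ζ_84])` carries a `Φ`-positive divisor of type `(K; Φ; (ϖ₀))` **iff `N_{K⁺/ℚ}(ϖ₀) > 0`** (part 55b
`exists_type_span_iff_norm_pos_of_even` + THEOREM L (i)/(ii) at `84` + `|S_Φ ∩ N_odd| ≡ n₋ = 2`); in particular NONE
of the generators of negative norm (the ramified `𝔮_p` and the surd types of parts 49–54) gives a type on this row.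
research route conditional on HC_CM; not a corollary; Q11.4-sentence-2 already refuted in dim ≥ 3. [cite: Shimura1998, §14.3 Prop. 4–5, pp. 103–104] -/
theorem exists_type_iff_norm_pos_eightyFour_sqrt_neg_twentyOne [IsCMField K] [IsCyclotomicExtension {84} ℚ K] (hζ : IsPrimitiveRoot ζ 84)
    (Φ : CMType K) (hbal : 2 * (SΦ84[Φ, ζ] ∩ ({13, 29, 43, 47, 53, 59, 61, 65, 67, 73, 79, 83} : Finset (ZMod 84))).card = (SΦ84[Φ, ζ]).card)
    {ϖ₀ : 𝓞 (maximalRealSubfield K)} (hϖ0 : ϖ₀ ≠ 0) :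
    (∃ ζ' : K, IsCMField.complexConj K ζ' = -ζ' ∧ (∀ φ : Φ.1, 0 < (φ.1 ζ').im) ∧
        CMTypeLattice.IsOfType (1 : (FractionalIdeal (𝓞 K)⁰ K)ˣ) ζ' (Ideal.span {ϖ₀})) ↔
      0 < Algebra.norm ℚ ((ϖ₀ : maximalRealSubfield K)) := by
  have hg : Nat.totient 84 = 2 * (11 + 1) := by decide
  refine exists_type_span_iff_norm_pos_of_even hζ hg Φ hϖ0 (norm_realUnits_pos_eightyFour hζ) (exists_units_sign_eq_eightyFour hζ Φ) ?_
  have hS := isCMTypeSet_residueFilter hζ Φ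
  have hNK : IsCMTypeSet 84 ({13, 29, 43, 47, 53, 59, 61, 65, 67, 73, 79, 83} : Finset (ZMod 84)) := by decide
  have h := card_inter_nodd_mod_two_eq (m := 84) (by norm_num) hS hNK hbal
  have hn : ((({13, 29, 43, 47, 53, 59, 61, 65, 67, 73, 79, 83} : Finset (ZMod 84))).filter fun t : ZMod 84 => 2 * t.val < 84).card % 2 = 0 := by
    decide
  rw [hn] at h
  exact Nat.even_iff.mpr h

/-- **DICHOTOMY AT LEVEL `84` for EVERY real generator of NEGATIVE norm**: for every one of the `2^24` CM types `Φ` of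
`ℚ(ζ_84)` and every `ϖ₀ ∈ 𝓞 K⁺` with `N_{K⁺/ℚ}(ϖ₀) < 0`, the torus `ℂ^Φ/Φ(ℤ[ζ_84])` carries EITHER an `ι`-compatible
principal polarisation OR a `Φ`-positive divisor of type `(ϖ₀)`, NEVER BOTH (part 55b `xor_principal_span_of_norm_neg` +
THEOREM L (i)/(ii) at `84`; parts 49–54's `exists_principal_xor_type_…` for all their generators at once).
research route conditional on HC_CM; not a corollary; Q11.4-sentence-2 already refuted in dim ≥ 3. [cite: Shimura1998, §14.3 Prop. 4–5, pp. 103–104] -/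
theorem xor_principal_type_eightyFour_of_norm_neg [IsCMField K] [IsCyclotomicExtension {84} ℚ K] (hζ : IsPrimitiveRoot ζ 84)
    (Φ : CMType K) {ϖ₀ : 𝓞 (maximalRealSubfield K)} (hneg : Algebra.norm ℚ ((ϖ₀ : maximalRealSubfield K)) < 0) :
    Xor (∃ ζ' : K, IsCMField.complexConj K ζ' = -ζ' ∧ (∀ φ : Φ.1, 0 < (φ.1 ζ').im) ∧
          CMTypeLattice.IsOfType (1 : (FractionalIdeal (𝓞 K)⁰ K)ˣ) ζ' ⊤)
      (∃ ζ' : K, IsCMField.complexConj K ζ' = -ζ' ∧ (∀ φ : Φ.1, 0 < (φ.1 ζ').im) ∧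
        CMTypeLattice.IsOfType (1 : (FractionalIdeal (𝓞 K)⁰ K)ˣ) ζ' (Ideal.span {ϖ₀})) := by
  have hg : Nat.totient 84 = 2 * (11 + 1) := by decide
  exact xor_principal_span_of_norm_neg Φ 1 (complexConj_xi hζ hg) (xi_ne_zero hζ 11) (isOfType_one_xi_top hζ 11) hneg
    (norm_realUnits_pos_eightyFour hζ) (exists_units_sign_eq_eightyFour hζ Φ)

/-- **POSITIVE norm at level `84`**: for every CM type `Φ` of `ℚ(ζ_84)` and every `ϖ₀ ∈ 𝓞 K⁺` with `N_{K⁺/ℚ}(ϖ₀) > 0`,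
type `(ϖ₀)` occurs on `ℂ^Φ/Φ(ℤ[ζ_84])` iff an `ι`-compatible principal polarisation does (part 55b
`exists_pos_isOfType_span_iff_principal_of_norm_pos` + THEOREM L (i)/(ii) at `84`).
research route conditional on HC_CM; not a corollary; Q11.4-sentence-2 already refuted in dim ≥ 3. [cite: Shimura1998, §14.3 Prop. 4–5, pp. 103–104] -/
theorem exists_type_iff_principal_eightyFour_of_norm_pos [IsCMField K] [IsCyclotomicExtension {84} ℚ K] (hζ : IsPrimitiveRoot ζ 84)
    (Φ : CMType K) {ϖ₀ : 𝓞 (maximalRealSubfield K)} (hpos : 0 < Algebra.norm ℚ ((ϖ₀ : maximalRealSubfield K))) :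
    (∃ ζ' : K, IsCMField.complexConj K ζ' = -ζ' ∧ (∀ φ : Φ.1, 0 < (φ.1 ζ').im) ∧
        CMTypeLattice.IsOfType (1 : (FractionalIdeal (𝓞 K)⁰ K)ˣ) ζ' (Ideal.span {ϖ₀})) ↔
      (∃ ζ' : K, IsCMField.complexConj K ζ' = -ζ' ∧ (∀ φ : Φ.1, 0 < (φ.1 ζ').im) ∧
          CMTypeLattice.IsOfType (1 : (FractionalIdeal (𝓞 K)⁰ K)ˣ) ζ' ⊤) := by
  have hg : Nat.totient 84 = 2 * (11 + 1) := by decide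
  exact exists_pos_isOfType_span_iff_principal_of_norm_pos Φ 1 (complexConj_xi hζ hg) (xi_ne_zero hζ 11)
    (isOfType_one_xi_top hζ 11) hpos (norm_realUnits_pos_eightyFour hζ) (exists_units_sign_eq_eightyFour hζ Φ)

end Level84

/-! ### Level `72` (`g = 24`) -/

section Level72

/-- the residue set `S_Φ` read at level `72`. -/
local notation3 (prettyPrint := false) "SΦ72[" Φ "," z "]" =>
  (Finset.univ.filter fun t : ZMod 72 => ∃ σ ∈ (Φ : CMType K).1, σ (z : K) = 𝐞 t)

open scoped Classical in
/-- **CENSUS ROW `(ℚ(ζ_72), ℚ(i))` — THE TYPE SPECTRUM (a YES row: an `ι`-compatible principal polarisation exists).**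
For every CM type `Φ` of `ℚ(ζ_72)` balanced for `N_K = [7, 11, 19, 23, 31, 35, 43, 47, 55, 59, 67, 71]` (`K = ℚ(i)`) and EVERY real integer `ϖ₀ ∈ 𝓞 K⁺ ∖ 0`:
`ℂ^Φ/Φ(ℤ[ζ_72])` carries a `Φ`-positive divisor of type `(K; Φ; (ϖ₀))` **iff `N_{K⁺/ℚ}(ϖ₀) > 0`** (part 55b
`exists_type_span_iff_norm_pos_of_even` + THEOREM L (i)/(ii) at `72` + `|S_Φ ∩ N_odd| ≡ n₋ = 6`); in particular NONE
of the generators of negative norm (the ramified `𝔮_p` and the surd types of parts 49–54) gives a type on this row.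
research route conditional on HC_CM; not a corollary; Q11.4-sentence-2 already refuted in dim ≥ 3. [cite: Shimura1998, §14.3 Prop. 4–5, pp. 103–104] -/
theorem exists_type_iff_norm_pos_seventyTwo_sqrt_neg_one [IsCMField K] [IsCyclotomicExtension {72} ℚ K] (hζ : IsPrimitiveRoot ζ 72)
    (Φ : CMType K) (hbal : 2 * (SΦ72[Φ, ζ] ∩ ({7, 11, 19, 23, 31, 35, 43, 47, 55, 59, 67, 71} : Finset (ZMod 72))).card = (SΦ72[Φ, ζ]).card)
    {ϖ₀ : 𝓞 (maximalRealSubfield K)} (hϖ0 : ϖ₀ ≠ 0) :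
    (∃ ζ' : K, IsCMField.complexConj K ζ' = -ζ' ∧ (∀ φ : Φ.1, 0 < (φ.1 ζ').im) ∧
        CMTypeLattice.IsOfType (1 : (FractionalIdeal (𝓞 K)⁰ K)ˣ) ζ' (Ideal.span {ϖ₀})) ↔
      0 < Algebra.norm ℚ ((ϖ₀ : maximalRealSubfield K)) := by
  have hg : Nat.totient 72 = 2 * (11 + 1) := by decide
  refine exists_type_span_iff_norm_pos_of_even hζ hg Φ hϖ0 (norm_realUnits_pos_seventyTwo hζ) (exists_units_sign_eq_seventyTwo hζ Φ) ?_
  have hS := isCMTypeSet_residueFilter hζ Φ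
  have hNK : IsCMTypeSet 72 ({7, 11, 19, 23, 31, 35, 43, 47, 55, 59, 67, 71} : Finset (ZMod 72)) := by decide
  have h := card_inter_nodd_mod_two_eq (m := 72) (by norm_num) hS hNK hbal
  have hn : ((({7, 11, 19, 23, 31, 35, 43, 47, 55, 59, 67, 71} : Finset (ZMod 72))).filter fun t : ZMod 72 => 2 * t.val < 72).card % 2 = 0 := by
    decide
  rw [hn] at h
  exact Nat.even_iff.mpr h

open scoped Classical in
/-- **CENSUS ROW `(ℚ(ζ_72), ℚ(√−2))` — THE TYPE SPECTRUM (a YES row: an `ι`-compatible principal polarisation exists).**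
For every CM type `Φ` of `ℚ(ζ_72)` balanced for `N_K = [5, 7, 13, 23, 29, 31, 37, 47, 53, 55, 61, 71]` (`K = ℚ(√−2)`) and EVERY real integer `ϖ₀ ∈ 𝓞 K⁺ ∖ 0`:
`ℂ^Φ/Φ(ℤ[ζ_72])` carries a `Φ`-positive divisor of type `(K; Φ; (ϖ₀))` **iff `N_{K⁺/ℚ}(ϖ₀) > 0`** (part 55b
`exists_type_span_iff_norm_pos_of_even` + THEOREM L (i)/(ii) at `72` + `|S_Φ ∩ N_odd| ≡ n₋ = 6`); in particular NONE
of the generators of negative norm (the ramified `𝔮_p` and the surd types of parts 49–54) gives a type on this row.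
research route conditional on HC_CM; not a corollary; Q11.4-sentence-2 already refuted in dim ≥ 3. [cite: Shimura1998, §14.3 Prop. 4–5, pp. 103–104] -/
theorem exists_type_iff_norm_pos_seventyTwo_sqrt_neg_two [IsCMField K] [IsCyclotomicExtension {72} ℚ K] (hζ : IsPrimitiveRoot ζ 72)
    (Φ : CMType K) (hbal : 2 * (SΦ72[Φ, ζ] ∩ ({5, 7, 13, 23, 29, 31, 37, 47, 53, 55, 61, 71} : Finset (ZMod 72))).card = (SΦ72[Φ, ζ]).card)
    {ϖ₀ : 𝓞 (maximalRealSubfield K)} (hϖ0 : ϖ₀ ≠ 0) :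
    (∃ ζ' : K, IsCMField.complexConj K ζ' = -ζ' ∧ (∀ φ : Φ.1, 0 < (φ.1 ζ').im) ∧
        CMTypeLattice.IsOfType (1 : (FractionalIdeal (𝓞 K)⁰ K)ˣ) ζ' (Ideal.span {ϖ₀})) ↔
      0 < Algebra.norm ℚ ((ϖ₀ : maximalRealSubfield K)) := by
  have hg : Nat.totient 72 = 2 * (11 + 1) := by decide
  refine exists_type_span_iff_norm_pos_of_even hζ hg Φ hϖ0 (norm_realUnits_pos_seventyTwo hζ) (exists_units_sign_eq_seventyTwo hζ Φ) ?_
  have hS := isCMTypeSet_residueFilter hζ Φ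
  have hNK : IsCMTypeSet 72 ({5, 7, 13, 23, 29, 31, 37, 47, 53, 55, 61, 71} : Finset (ZMod 72)) := by decide
  have h := card_inter_nodd_mod_two_eq (m := 72) (by norm_num) hS hNK hbal
  have hn : ((({5, 7, 13, 23, 29, 31, 37, 47, 53, 55, 61, 71} : Finset (ZMod 72))).filter fun t : ZMod 72 => 2 * t.val < 72).card % 2 = 0 := by
    decide
  rw [hn] at h
  exact Nat.even_iff.mpr h

open scoped Classical in
/-- **CENSUS ROW `(ℚ(ζ_72), ℚ(√−3))` — THE TYPE SPECTRUM (a YES row: an `ι`-compatible principal polarisation exists).**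
For every CM type `Φ` of `ℚ(ζ_72)` balanced for `N_K = [5, 11, 17, 23, 29, 35, 41, 47, 53, 59, 65, 71]` (`K = ℚ(√−3)`) and EVERY real integer `ϖ₀ ∈ 𝓞 K⁺ ∖ 0`:
`ℂ^Φ/Φ(ℤ[ζ_72])` carries a `Φ`-positive divisor of type `(K; Φ; (ϖ₀))` **iff `N_{K⁺/ℚ}(ϖ₀) > 0`** (part 55b
`exists_type_span_iff_norm_pos_of_even` + THEOREM L (i)/(ii) at `72` + `|S_Φ ∩ N_odd| ≡ n₋ = 6`); in particular NONE
of the generators of negative norm (the ramified `𝔮_p` and the surd types of parts 49–54) gives a type on this row.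
research route conditional on HC_CM; not a corollary; Q11.4-sentence-2 already refuted in dim ≥ 3. [cite: Shimura1998, §14.3 Prop. 4–5, pp. 103–104] -/
theorem exists_type_iff_norm_pos_seventyTwo_sqrt_neg_three [IsCMField K] [IsCyclotomicExtension {72} ℚ K] (hζ : IsPrimitiveRoot ζ 72)
    (Φ : CMType K) (hbal : 2 * (SΦ72[Φ, ζ] ∩ ({5, 11, 17, 23, 29, 35, 41, 47, 53, 59, 65, 71} : Finset (ZMod 72))).card = (SΦ72[Φ, ζ]).card)
    {ϖ₀ : 𝓞 (maximalRealSubfield K)} (hϖ0 : ϖ₀ ≠ 0) :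
    (∃ ζ' : K, IsCMField.complexConj K ζ' = -ζ' ∧ (∀ φ : Φ.1, 0 < (φ.1 ζ').im) ∧
        CMTypeLattice.IsOfType (1 : (FractionalIdeal (𝓞 K)⁰ K)ˣ) ζ' (Ideal.span {ϖ₀})) ↔
      0 < Algebra.norm ℚ ((ϖ₀ : maximalRealSubfield K)) := by
  have hg : Nat.totient 72 = 2 * (11 + 1) := by decide
  refine exists_type_span_iff_norm_pos_of_even hζ hg Φ hϖ0 (norm_realUnits_pos_seventyTwo hζ) (exists_units_sign_eq_seventyTwo hζ Φ) ?_
  have hS := isCMTypeSet_residueFilter hζ Φ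
  have hNK : IsCMTypeSet 72 ({5, 11, 17, 23, 29, 35, 41, 47, 53, 59, 65, 71} : Finset (ZMod 72)) := by decide
  have h := card_inter_nodd_mod_two_eq (m := 72) (by norm_num) hS hNK hbal
  have hn : ((({5, 11, 17, 23, 29, 35, 41, 47, 53, 59, 65, 71} : Finset (ZMod 72))).filter fun t : ZMod 72 => 2 * t.val < 72).card % 2 = 0 := by
    decide
  rw [hn] at h
  exact Nat.even_iff.mpr h

open scoped Classical in
/-- **CENSUS ROW `(ℚ(ζ_72), ℚ(√−6))` — THE TYPE SPECTRUM (a YES row: an `ι`-compatible principal polarisation exists).**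
For every CM type `Φ` of `ℚ(ζ_72)` balanced for `N_K = [13, 17, 19, 23, 37, 41, 43, 47, 61, 65, 67, 71]` (`K = ℚ(√−6)`) and EVERY real integer `ϖ₀ ∈ 𝓞 K⁺ ∖ 0`:
`ℂ^Φ/Φ(ℤ[ζ_72])` carries a `Φ`-positive divisor of type `(K; Φ; (ϖ₀))` **iff `N_{K⁺/ℚ}(ϖ₀) > 0`** (part 55b
`exists_type_span_iff_norm_pos_of_even` + THEOREM L (i)/(ii) at `72` + `|S_Φ ∩ N_odd| ≡ n₋ = 4`); in particular NONE
of the generators of negative norm (the ramified `𝔮_p` and the surd types of parts 49–54) gives a type on this row.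
research route conditional on HC_CM; not a corollary; Q11.4-sentence-2 already refuted in dim ≥ 3. [cite: Shimura1998, §14.3 Prop. 4–5, pp. 103–104] -/
theorem exists_type_iff_norm_pos_seventyTwo_sqrt_neg_six [IsCMField K] [IsCyclotomicExtension {72} ℚ K] (hζ : IsPrimitiveRoot ζ 72)
    (Φ : CMType K) (hbal : 2 * (SΦ72[Φ, ζ] ∩ ({13, 17, 19, 23, 37, 41, 43, 47, 61, 65, 67, 71} : Finset (ZMod 72))).card = (SΦ72[Φ, ζ]).card)
    {ϖ₀ : 𝓞 (maximalRealSubfield K)} (hϖ0 : ϖ₀ ≠ 0) :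
    (∃ ζ' : K, IsCMField.complexConj K ζ' = -ζ' ∧ (∀ φ : Φ.1, 0 < (φ.1 ζ').im) ∧
        CMTypeLattice.IsOfType (1 : (FractionalIdeal (𝓞 K)⁰ K)ˣ) ζ' (Ideal.span {ϖ₀})) ↔
      0 < Algebra.norm ℚ ((ϖ₀ : maximalRealSubfield K)) := by
  have hg : Nat.totient 72 = 2 * (11 + 1) := by decide
  refine exists_type_span_iff_norm_pos_of_even hζ hg Φ hϖ0 (norm_realUnits_pos_seventyTwo hζ) (exists_units_sign_eq_seventyTwo hζ Φ) ?_
  have hS := isCMTypeSet_residueFilter hζ Φ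
  have hNK : IsCMTypeSet 72 ({13, 17, 19, 23, 37, 41, 43, 47, 61, 65, 67, 71} : Finset (ZMod 72)) := by decide
  have h := card_inter_nodd_mod_two_eq (m := 72) (by norm_num) hS hNK hbal
  have hn : ((({13, 17, 19, 23, 37, 41, 43, 47, 61, 65, 67, 71} : Finset (ZMod 72))).filter fun t : ZMod 72 => 2 * t.val < 72).card % 2 = 0 := by
    decide
  rw [hn] at h
  exact Nat.even_iff.mpr h

/-- **DICHOTOMY AT LEVEL `72` for EVERY real generator of NEGATIVE norm**: for every one of the `2^24` CM types `Φ` of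
`ℚ(ζ_72)` and every `ϖ₀ ∈ 𝓞 K⁺` with `N_{K⁺/ℚ}(ϖ₀) < 0`, the torus `ℂ^Φ/Φ(ℤ[ζ_72])` carries EITHER an `ι`-compatible
principal polarisation OR a `Φ`-positive divisor of type `(ϖ₀)`, NEVER BOTH (part 55b `xor_principal_span_of_norm_neg` +
THEOREM L (i)/(ii) at `72`; parts 49–54's `exists_principal_xor_type_…` for all their generators at once).
research route conditional on HC_CM; not a corollary; Q11.4-sentence-2 already refuted in dim ≥ 3. [cite: Shimura1998, §14.3 Prop. 4–5, pp. 103–104] -/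
theorem xor_principal_type_seventyTwo_of_norm_neg [IsCMField K] [IsCyclotomicExtension {72} ℚ K] (hζ : IsPrimitiveRoot ζ 72)
    (Φ : CMType K) {ϖ₀ : 𝓞 (maximalRealSubfield K)} (hneg : Algebra.norm ℚ ((ϖ₀ : maximalRealSubfield K)) < 0) :
    Xor (∃ ζ' : K, IsCMField.complexConj K ζ' = -ζ' ∧ (∀ φ : Φ.1, 0 < (φ.1 ζ').im) ∧
          CMTypeLattice.IsOfType (1 : (FractionalIdeal (𝓞 K)⁰ K)ˣ) ζ' ⊤)
      (∃ ζ' : K, IsCMField.complexConj K ζ' = -ζ' ∧ (∀ φ : Φ.1, 0 < (φ.1 ζ').im) ∧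
        CMTypeLattice.IsOfType (1 : (FractionalIdeal (𝓞 K)⁰ K)ˣ) ζ' (Ideal.span {ϖ₀})) := by
  have hg : Nat.totient 72 = 2 * (11 + 1) := by decide
  exact xor_principal_span_of_norm_neg Φ 1 (complexConj_xi hζ hg) (xi_ne_zero hζ 11) (isOfType_one_xi_top hζ 11) hneg
    (norm_realUnits_pos_seventyTwo hζ) (exists_units_sign_eq_seventyTwo hζ Φ)

/-- **POSITIVE norm at level `72`**: for every CM type `Φ` of `ℚ(ζ_72)` and every `ϖ₀ ∈ 𝓞 K⁺` with `N_{K⁺/ℚ}(ϖ₀) > 0`,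
type `(ϖ₀)` occurs on `ℂ^Φ/Φ(ℤ[ζ_72])` iff an `ι`-compatible principal polarisation does (part 55b
`exists_pos_isOfType_span_iff_principal_of_norm_pos` + THEOREM L (i)/(ii) at `72`).
research route conditional on HC_CM; not a corollary; Q11.4-sentence-2 already refuted in dim ≥ 3. [cite: Shimura1998, §14.3 Prop. 4–5, pp. 103–104] -/
theorem exists_type_iff_principal_seventyTwo_of_norm_pos [IsCMField K] [IsCyclotomicExtension {72} ℚ K] (hζ : IsPrimitiveRoot ζ 72)
    (Φ : CMType K) {ϖ₀ : 𝓞 (maximalRealSubfield K)} (hpos : 0 < Algebra.norm ℚ ((ϖ₀ : maximalRealSubfield K))) :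
    (∃ ζ' : K, IsCMField.complexConj K ζ' = -ζ' ∧ (∀ φ : Φ.1, 0 < (φ.1 ζ').im) ∧
        CMTypeLattice.IsOfType (1 : (FractionalIdeal (𝓞 K)⁰ K)ˣ) ζ' (Ideal.span {ϖ₀})) ↔
      (∃ ζ' : K, IsCMField.complexConj K ζ' = -ζ' ∧ (∀ φ : Φ.1, 0 < (φ.1 ζ').im) ∧
          CMTypeLattice.IsOfType (1 : (FractionalIdeal (𝓞 K)⁰ K)ˣ) ζ' ⊤) := by
  have hg : Nat.totient 72 = 2 * (11 + 1) := by decide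
  exact exists_pos_isOfType_span_iff_principal_of_norm_pos Φ 1 (complexConj_xi hζ hg) (xi_ne_zero hζ 11)
    (isOfType_one_xi_top hζ 11) hpos (norm_realUnits_pos_seventyTwo hζ) (exists_units_sign_eq_seventyTwo hζ Φ)

end Level72

end Summit.HodgeConjecture.Ring2WeilCoverage.TypeNormSignLevelsG12B

end
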